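import Summits.NavierStokesRegularity.NavierStokesRegularity.Theorems.EulerZoomLiouvillePowerGaugeEulerLiouvilleBackwardVanishing
import HarnessLib

/-!
# Backward vanishing of the GRADIENT and off-centre balls (route `EulerZoomLiouville`, crux
# `PowerGaugeEulerLiouville` = stmt-NavierStokesRegularity-19832, line `birth`, around STUB 2
# `stub_backwardVanishing`)

Helper file (theorems only).  Two corollaries of the backward-vanishing machinery
(`…BackwardVanishing.lean`, `…BackwardTools.lean`) recorded for the authors of the OPEN core
`stub_noCollapseFromZero`, whose hypothesis is the conclusion `VanishesBackward u` of STUB 2: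

* `gradVanishesBackward_of_gaugeE` — under the `E`-gauge `a^ρ E(H; Q_a(0)) ≤ c` alone (`ρ` real,
  any sign), for every `R, ε > 0` the proportion of times `τ ∈ (-a², 0)` with
  `∫_{B(0,R)} |H(τ)|²_F > ε` is `≤ (c/ε) a^{-1-ρ}`, hence tends to `0` as `a → ∞` when `ρ > -1`
  (Chebyshev in time, `mul_volume_sep_le_setLIntegral_prod`, on `setLIntegral_window_le_of_gaugeE`):
  along density-one sets of times BOTH `u(τ) → 0` (STUB 2) and `∇u(τ) → 0` in `L²(B_R)`;
* `vanishesBackward_ball_of_gauge` — STUB 2 on balls `B(x₀, R)` with arbitrary centre (the gauge is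
  at the origin; `B(x₀, R) ⊆ B(0, R + ‖x₀‖)`).

WHAT THIS IS NOT: not NS / Euler and not the crux; the Euler system, the local energy inequality and
the `D`-gauge are still unused. [folklore]
-/

noncomputable section

-- the summit and its single problem share the name `NavierStokesRegularity` (D-0017 nested layout)
set_option linter.dupNamespace false

open MeasureTheory Set Filter Topology Metric Module TopologicalSpace Function
open scoped NNReal ENNReal

namespace Summit.NavierStokesRegularity.NavierStokesRegularity.Theorems.PowerGaugeEulerLiouville.Backward

open Literature.Analysis Literature.Analysis.FunctionSpaces Literature.Analysis.FluidPDE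
open Summit.NavierStokesRegularity.NavierStokesRegularity.Theorems.PowerGaugeEulerLiouville.TimePeriodic
  (setLIntegral_window_le_of_gaugeE)

variable {u : ℝ → EuclideanSpace ℝ (Fin 3) → EuclideanSpace ℝ (Fin 3)}
  {H : ℝ → EuclideanSpace ℝ (Fin 3) → EuclideanSpace ℝ (Fin 3) →L[ℝ] EuclideanSpace ℝ (Fin 3)}

/-- The dissipation density of a weak spatial gradient on the slab is a.e.-measurable on every
backward cylinder `(-a², 0) × B(0, R)`. [folklore] -/
theorem aemeasurable_dissipation_cylinder
    (hH : HasWeakSpatialGradientOn (slab (EuclideanSpace ℝ (Fin 3)) (Set.Iio 0) isOpen_Iio) u H)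
    (a R : ℝ) :
    AEMeasurable (fun q : ℝ × EuclideanSpace ℝ (Fin 3) => ENNReal.ofReal (frobeniusNormSq (H q.1 q.2)))
      (volume.restrict (Set.Ioo (-(a ^ 2)) 0 ×ˢ ball (0 : EuclideanSpace ℝ (Fin 3)) R)) := by
  have hsub : Set.Ioo (-(a ^ 2)) 0 ×ˢ ball (0 : EuclideanSpace ℝ (Fin 3)) R ⊆
      ((slab (EuclideanSpace ℝ (Fin 3)) (Set.Iio 0) isOpen_Iio : Opens _) :
        Set (ℝ × EuclideanSpace ℝ (Fin 3))) := by
    rw [coe_slab]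
    exact prod_mono Ioo_subset_Iio_self (subset_univ _)
  have hsm : AEStronglyMeasurable (uncurry H)
      (volume.restrict (Set.Ioo (-(a ^ 2)) 0 ×ˢ ball (0 : EuclideanSpace ℝ (Fin 3)) R)) :=
    hH.locallyIntegrableOn_grad.aestronglyMeasurable.mono_measure (Measure.restrict_mono hsub le_rfl)
  exact ((ENNReal.continuous_ofReal.comp continuous_frobeniusNormSq').comp_aestronglyMeasurable
    hsm).aemeasurable

/-- **Backward vanishing of the gradient under the `E`-gauge.**  If `H` is a weak spatial gradient
of `u` on the slab `ℝ³ × (-∞, 0)` and `a^ρ E(H; Q_a(0)) ≤ c` for all `a > 0`, with `ρ > -1`, then for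
every `R` and `ε > 0` the proportion of times `τ ∈ (-a², 0)` at which `∫_{B(0,R)} |H(τ)|²_F > ε` tends
to `0` as `a → ∞`: Chebyshev in time gives `ε · |{bad}| ≤ ∫∫_{(-a²,0)×B_R} |H|²_F ≤ c a^{1-ρ}`, so
the proportion is `≤ (c/ε) a^{-1-ρ}`. [folklore] -/
theorem gradVanishesBackward_of_gaugeE {ρ : ℝ} (hρ : -1 < ρ) {c : ℝ≥0}
    (hH : HasWeakSpatialGradientOn (slab (EuclideanSpace ℝ (Fin 3)) (Set.Iio 0) isOpen_Iio) u H)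
    (hE : ∀ a : ℝ, 0 < a →
      ENNReal.ofReal (a ^ ρ) * cknE a (0 : ℝ × EuclideanSpace ℝ (Fin 3)) H ≤ (c : ℝ≥0∞))
    (R : ℝ) {ε : ℝ} (hε : 0 < ε) :
    Tendsto (fun a : ℝ =>
        volume {τ : ℝ | τ ∈ Set.Ioo (-(a ^ 2)) 0 ∧
            ENNReal.ofReal ε < ∫⁻ y in ball (0 : EuclideanSpace ℝ (Fin 3)) R,
              ENNReal.ofReal (frobeniusNormSq (H τ y))} /
          ENNReal.ofReal (a ^ 2))
      atTop (𝓝 0) := by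
  have hrate : Tendsto (fun a : ℝ => ENNReal.ofReal ((c : ℝ) / ε * a ^ (-(1 + ρ)))) atTop (𝓝 0) := by
    have h1 : Tendsto (fun a : ℝ => (c : ℝ) / ε * a ^ (-(1 + ρ))) atTop (𝓝 0) := by
      have h := (tendsto_rpow_neg_atTop (by linarith : 0 < 1 + ρ)).const_mul ((c : ℝ) / ε)
      simpa using h
    have h := ENNReal.tendsto_ofReal h1
    rwa [ENNReal.ofReal_zero] at h
  refine tendsto_of_tendsto_of_tendsto_of_le_of_le' tendsto_const_nhds hrate
    (Eventually.of_forall fun _ => zero_le) ?_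
  filter_upwards [eventually_ge_atTop R, eventually_gt_atTop 0] with a haR ha0
  set S : Set ℝ := {τ ∈ Set.Ioo (-(a ^ 2)) 0 | ENNReal.ofReal ε ≤
    ∫⁻ y in ball (0 : EuclideanSpace ℝ (Fin 3)) R, ENNReal.ofReal (frobeniusNormSq (H τ y))} with hS
  have hsub : {τ : ℝ | τ ∈ Set.Ioo (-(a ^ 2)) 0 ∧
      ENNReal.ofReal ε < ∫⁻ y in ball (0 : EuclideanSpace ℝ (Fin 3)) R,
        ENNReal.ofReal (frobeniusNormSq (H τ y))} ⊆ S := fun τ hτ => ⟨hτ.1, hτ.2.le⟩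
  have hcheb : ENNReal.ofReal ε * volume S ≤ ENNReal.ofReal ((c : ℝ) * a ^ (1 - ρ)) :=
    (mul_volume_sep_le_setLIntegral_prod (aemeasurable_dissipation_cylinder hH a R) _).trans
      (setLIntegral_window_le_of_gaugeE ha0 haR le_rfl (hE a ha0))
  have ha2 : 0 < a ^ 2 := by positivity
  calc volume {τ : ℝ | τ ∈ Set.Ioo (-(a ^ 2)) 0 ∧
          ENNReal.ofReal ε < ∫⁻ y in ball (0 : EuclideanSpace ℝ (Fin 3)) R,
            ENNReal.ofReal (frobeniusNormSq (H τ y))} / ENNReal.ofReal (a ^ 2)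
      ≤ volume S / ENNReal.ofReal (a ^ 2) := by gcongr
    _ ≤ (ENNReal.ofReal ((c : ℝ) * a ^ (1 - ρ)) / ENNReal.ofReal ε) / ENNReal.ofReal (a ^ 2) := by
        gcongr
        rw [ENNReal.le_div_iff_mul_le (Or.inl (ENNReal.ofReal_pos.2 hε).ne') (Or.inl ENNReal.ofReal_ne_top),
          mul_comm]
        exact hcheb
    _ = ENNReal.ofReal ((c : ℝ) * a ^ (1 - ρ) / ε / a ^ 2) := by
        rw [ENNReal.ofReal_div_of_pos ha2, ENNReal.ofReal_div_of_pos hε]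
    _ = ENNReal.ofReal ((c : ℝ) / ε * a ^ (-(1 + ρ))) := by
        congr 1
        have e : a ^ (-(1 + ρ)) = a ^ (1 - ρ) / a ^ 2 := by
          rw [show (-(1 + ρ)) = (1 - ρ) - 2 by ring, Real.rpow_sub ha0, Real.rpow_two]
        rw [e]
        ring

/-- **STUB 2 on off-centre balls.**  Under the hypotheses of `vanishesBackward_of_gauge`, for every
centre `x₀`, radius `R > 0` and `ε > 0` the proportion of times `τ ∈ (-a², 0)` with
`∫_{B(x₀,R)} |u(τ)|² > ε` tends to `0` (`B(x₀, R) ⊆ B(0, R + ‖x₀‖)`). [folklore] -/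
theorem vanishesBackward_ball_of_gauge {ρ : ℝ} (hρ : 0 < ρ) {c : ℝ≥0}
    (hH : HasWeakSpatialGradientOn (slab (EuclideanSpace ℝ (Fin 3)) (Set.Iio 0) isOpen_Iio) u H)
    (hA : ∀ a : ℝ, 0 < a →
      ENNReal.ofReal (a ^ (2 * ρ)) * cknA a (0 : ℝ × EuclideanSpace ℝ (Fin 3)) u ≤ (c : ℝ≥0∞))
    (hE : ∀ a : ℝ, 0 < a →
      ENNReal.ofReal (a ^ ρ) * cknE a (0 : ℝ × EuclideanSpace ℝ (Fin 3)) H ≤ (c : ℝ≥0∞))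
    (x₀ : EuclideanSpace ℝ (Fin 3)) {R ε : ℝ} (hR : 0 < R) (hε : 0 < ε) :
    Tendsto (fun a : ℝ =>
        volume {τ : ℝ | τ ∈ Set.Ioo (-(a ^ 2)) 0 ∧
            ENNReal.ofReal ε < ∫⁻ y in ball x₀ R, ‖u τ y‖ₑ ^ 2} / ENNReal.ofReal (a ^ 2))
      atTop (𝓝 0) := by
  have hR' : 0 < R + ‖x₀‖ := by positivity
  have hball : ball x₀ R ⊆ ball (0 : EuclideanSpace ℝ (Fin 3)) (R + ‖x₀‖) := by
    intro y hy
    rw [mem_ball, dist_zero_right]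
    calc ‖y‖ = ‖(y - x₀) + x₀‖ := by rw [sub_add_cancel]
      _ ≤ ‖y - x₀‖ + ‖x₀‖ := norm_add_le _ _
      _ < R + ‖x₀‖ := by
          have h : ‖y - x₀‖ < R := by rwa [mem_ball, dist_eq_norm] at hy
          linarith
  have h0 := vanishesBackward_of_gauge hρ hH hA hE hR' hε
  refine tendsto_of_tendsto_of_tendsto_of_le_of_le' tendsto_const_nhds h0
    (Eventually.of_forall fun _ => zero_le) (Eventually.of_forall fun a => ?_)
  gcongr volume ?_ / _
  intro τ hτ
  exact ⟨hτ.1, lt_of_lt_of_le hτ.2 (lintegral_mono_set hball)⟩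

end Summit.NavierStokesRegularity.NavierStokesRegularity.Theorems.PowerGaugeEulerLiouville.Backward

end
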